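import Literature.NumberTheory.DiophantineGeometry.GeneralizedFermatTwoPowerCoefficientFreyProofs
import Literature.NumberTheory.EllipticCurves.SzpiroFreyConductorProofs
import Literature.NumberTheory.Automorphic.CDTTheorem722
import Literature.NumberTheory.Automorphic.BCDTTheoremB
import HarnessLib

/-!
# `stub_liftThree` — ideator k3 (gen 2), HOME FAMILY 3 "probe the extremes": typed companion (core)

Companion to `STUB-IDEAS-stub_liftThree-3.md` (crux `FreyModularity`, item `stmt-ABC-11340`,
line `Lines/Sketch.lean`).  Literature-only imports (the farm's `Summits.ABC.ABC.Theorems.*` oleans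
were stale when this was written); the two PROVED certificates that need landed Summits theorems —
E1 (non-vacuity instance at the CM corner) and E2 (a Frey curve is never good-ordinary at `3`) — are
in the sibling file `STUB_IDEAS_stub_liftThree_3_Instances.lean`.

* `LiftThree` — the stub verbatim (= k2's `StubIdeas2.LiftThree`).
* E3 `LiftThreeSupersingular`, `LiftThreeOrdinary`, `liftThree_of_supersingular_of_ordinary` —
  PROVED glue: the flat-vs-Selmer cut of the local condition at `3` (Wiles 1995 Ch. 1 (i)(a)/(b);
  de Shalit, CSS 1997, "type Σ" (b) "finite flat or ordinary at ℓ"), refining k2's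
  good/multiplicative `liftThree_of_regimes`.
* E4 `SqTransferFive`, `sqTransfer_of_isTorsionGaloisRep_five` — NEW helper (the one `sorry`; one
  prover cycle: `stub_nineTransfer` with `3 ↦ q`) and its use-site corollary
  `switched_not_sq_dvd_of_frey` (PROVED from E4 as a hypothesis): in case B of `liftThree_of_stubs`
  the switched curve is semistable at every odd prime `q ≠ 5`.
* E5 `liftThree_of_CDT_theorem_7_2_1` — the conditional closer (= the skeleton's
  `stub_liftThree_of_CDT_theorem_7_2_1`, over `LiftThree`; `IsModular.isModularGaloisRepTate` is a
  tree theorem).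
-/

noncomputable section

open scoped MatrixGroups NumberField
open Literature.NumberTheory.EllipticCurves Literature.NumberTheory.EllipticCurves.ModularForms
open Literature.NumberTheory.Automorphic Literature.NumberTheory.Automorphic.BCDT
open Literature.NumberTheory.GaloisRepresentations
open WeierstrassCurve IsDedekindDomain NumberField

namespace Summit.ABC.ABC.Cruxes.FreyModularity.StubIdeas3

/-- The stub `stub_liftThree` of `Lines/Sketch.lean`, verbatim (= k2's `StubIdeas2.LiftThree`). -/
def LiftThree : Prop :=
  ∀ (W : WeierstrassCurve ℚ) [W.IsElliptic] (ρ : ModPGaloisRep ℚ (ZMod 3) 2),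
    W.IsTorsionGaloisRep 3 ρ → ρ.IsAbsIrreducibleOverSqrt (-3) → ¬ 9 ∣ W.conductorNorm ℤ →
      ρ.IsModular → W.IsModularGaloisRepTate 3

/-! ## E3. The flat / Selmer cut of the local condition at `3` (glue PROVED) -/

/-- Regime SS (Wiles' flat case (i)(b): `ρ̄|G₃` irreducible of niveau 2): good supersingular at `3`. -/
def LiftThreeSupersingular : Prop :=
  ∀ (W : WeierstrassCurve ℚ) [W.IsElliptic] (ρ : ModPGaloisRep ℚ (ZMod 3) 2),
    W.IsTorsionGaloisRep 3 ρ → ρ.IsAbsIrreducibleOverSqrt (-3) → W.HasGoodReductionAtPrime 3 →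
      (3 : ℤ) ∣ W.LFunction 3 → ρ.IsModular → W.IsModularGaloisRepTate 3

/-- Regime ORD (Wiles' Selmer case (i)(a): good ordinary or multiplicative at `3`). -/
def LiftThreeOrdinary : Prop :=
  ∀ (W : WeierstrassCurve ℚ) [W.IsElliptic] (ρ : ModPGaloisRep ℚ (ZMod 3) 2),
    W.IsTorsionGaloisRep 3 ρ → ρ.IsAbsIrreducibleOverSqrt (-3) → ¬ 9 ∣ W.conductorNorm ℤ →
      ¬ (W.HasGoodReductionAtPrime 3 ∧ (3 : ℤ) ∣ W.LFunction 3) → ρ.IsModular →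
        W.IsModularGaloisRepTate 3

/-- Glue: the two local deformation theories at `3` cover the stub (excluded middle). -/
theorem liftThree_of_supersingular_of_ordinary (hss : LiftThreeSupersingular)
    (hord : LiftThreeOrdinary) : LiftThree := by
  intro W _ ρ hρ hirr h9 hmod
  by_cases h : W.HasGoodReductionAtPrime 3 ∧ (3 : ℤ) ∣ W.LFunction 3
  · exact hss W ρ hρ hirr h.1 h.2 hmod
  · exact hord W ρ hρ hirr h9 h hmod

/-! ## E4. Use-site class away from `3`: square-freeness transfers along `W'[5] ≅ W[5]` -/

/-- NEW helper (one cycle; `stub_nineTransfer` with `3 ↦ q`): for elliptic `W, W'/ℚ` with a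
common framed model of the `5`-torsion and a prime `q ≠ 5`, `q² ∤ N_W ⇒ q² ∤ N_{W'}`.  Proof
recipe: `sq_dvd_conductorNorm_iff_hasAdditiveReductionAt`, a non-zero `I_𝔓`-fixed `P ∈ W[5]`
(`exists_ne_zero_smul_eq_of_not_hasAdditiveReductionAt`, `q ∤ 5`), transported along `ρ̄`
(`exists_torsion_of_isTorsionGaloisRep`), killed by `stub_nineTransfer_torsion` (`ℓ = 5 > 4`). -/
def SqTransferFive : Prop :=
  ∀ (W W' : WeierstrassCurve ℚ) [W.IsElliptic] [W'.IsElliptic] {q : ℕ}, q.Prime → q ≠ 5 →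
    ∀ ρ : ModPGaloisRep ℚ (ZMod 5) 2, W.IsTorsionGaloisRep 5 ρ → W'.IsTorsionGaloisRep 5 ρ →
      ¬ q ^ 2 ∣ W.conductorNorm ℤ → ¬ q ^ 2 ∣ W'.conductorNorm ℤ

theorem sqTransfer_of_isTorsionGaloisRep_five : SqTransferFive := by
  sorry

/-- Use-site corollary (case B of `liftThree_of_stubs`): the switched curve `W'` with
`W'[5] ≅ E_(a,b)[5]` is semistable at every odd prime `q ≠ 5` — the Frey side `q² ∤ N_{E_(a,b)}`
is `conductorNorm_freyCurve_dvd_holds` + square-freeness of the radical (landed as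
`XiBound.Negative.not_sq_dvd_conductorNorm_freyCurve`; re-derived inline). -/
theorem switched_not_sq_dvd_of_frey (hT : SqTransferFive) {a b : ℤ} (hab : IsCoprime a b)
    (h0 : a * b * (a + b) ≠ 0) (W' : WeierstrassCurve ℚ) [W'.IsElliptic]
    (ρ : ModPGaloisRep ℚ (ZMod 5) 2) (hρ : (freyCurve a b).IsTorsionGaloisRep 5 ρ)
    (hρ' : W'.IsTorsionGaloisRep 5 ρ) {q : ℕ} (hq : q.Prime) (hq2 : q ≠ 2) (hq5 : q ≠ 5) :
    ¬ q ^ 2 ∣ W'.conductorNorm ℤ := by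
  haveI := isElliptic_freyCurve h0
  refine hT (freyCurve a b) W' hq hq5 ρ hρ hρ' ?_
  intro hsqN
  have hqq : q ^ 2 ∣ 2 ^ 8 * (UniqueFactorizationMonoid.radical (a * b * (a + b))).natAbs :=
    hsqN.trans (conductorNorm_freyCurve_dvd_holds a b hab h0)
  have hcop : Nat.Coprime (q ^ 2) (2 ^ 8) :=
    Nat.Coprime.pow 2 8 ((Nat.coprime_primes hq Nat.prime_two).mpr hq2)
  have hsqR : Squarefree (UniqueFactorizationMonoid.radical (a * b * (a + b))).natAbs :=
    Int.squarefree_natAbs.mpr UniqueFactorizationMonoid.squarefree_radical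
  have hqR : q * q ∣ (UniqueFactorizationMonoid.radical (a * b * (a + b))).natAbs := by
    rw [← pow_two]; exact hcop.dvd_of_dvd_mul_left hqq
  exact hq.one_lt.ne' (Nat.isUnit_iff.mp (hsqR q hqR))

/-! ## E5. The conditional closer (as in the skeleton), over `LiftThree` -/

/-- `CDT_theorem_7_2_1` (`27 ∤ N`) ⇒ the stub (`9 ∤ N`): `E` modular ⇒ `ρ_{E,3}` modular
(`IsModular.isModularGaloisRepTate`, PROVED in the tree). -/
theorem liftThree_of_CDT_theorem_7_2_1 (h : CDT_theorem_7_2_1) : LiftThree := by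
  intro W _ ρ hρ hirr h9 _
  haveI : Fact (Nat.Prime 3) := ⟨Nat.prime_three⟩
  haveI : NeZero (W.conductorNorm ℤ) := ⟨(conductorNorm_pos_holds _).ne'⟩
  exact (h W ρ hρ hirr fun h27 ↦ h9 ((show (9 : ℕ) ∣ 27 by norm_num).trans h27)).isModularGaloisRepTate 3

end Summit.ABC.ABC.Cruxes.FreyModularity.StubIdeas3

end
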